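import Mathlib.Algebra.Order.Field.Basic
import Mathlib.Algebra.Order.BigOperators.Group.Finset
import Mathlib.Algebra.BigOperators.Group.Finset.Basic
import Mathlib.Data.Finset.Max
import Mathlib.Tactic.FieldSimp
import Mathlib.Tactic.Ring
import Mathlib.Tactic.Linarith
import Mathlib.Tactic.Positivity
import Mathlib.Tactic.LinearCombination
import Literature.ComputerArithmetic.ConnollyHighamMary2021.StochasticRounding
import HarnessLib

/-!
# Stochastic rounding into a finite format, I: hull, saturation, one step

HONEST FRAMING: certified error envelopes and provably optimal rounding/accumulation schemes for
low-precision formats under stated cost models; every table by two implementations; no hardware or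
vendor claims.

Venture CertifiedArithmetic / lowprec, stochastic-rounding (SR) slice, file 1 of 3. New work (not
literature): mode-2 stochastic rounding (`Literature.ComputerArithmetic.ConnollyHighamMary2021`) into
an arbitrary nonempty FINITE number system `F` (a `Finset` of a linearly ordered field; for the OCP
FP8/FP6/FP4 and MX element formats take `K = ℚ` and `F` the finite value set, subnormals and all),
with SATURATION (`clamp` into the representable hull `[min F, max F]`, OCP "satfinite") made part of the
semantics.

* `InHull`, `clamp`, `up`/`dn`/`pUp` — candidates and up-probability of the saturating SR step;
* `step F c f = E[f(SR(c))]` — the one-step expectation operator; linear, monotone;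
* `step_id`, `step_id_eq_self_iff` — **one saturating SR step has mean `clamp F c`; it is unbiased
  EXACTLY when the pre-rounding value lies in the hull** (saturation is the only obstruction to CHM21
  Lemma 4.4 on a finite format: subnormal spacing and ties are not);
* `step_centered` — mean independence (CHM21 Lemma 4.5) in this model; `step_sq_add` — the one-step
  second moment splits as El Arar et al.'s conditional variance `v_F(c̄) = (c̄ − ⌊c̄⌋)(⌈c̄⌉ − c̄)` plus
  the squared shift.

Files II (`SRAccumulation`: recursive summation, exact mean decomposition and variance identity) and
III (`SREnvelopes`: `n G²/4` growth, pair-table envelopes, Chebyshev `√n` bound, sure bound) build on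
this. Formats with infinities (IEEE-style E5M2 overflow) are NOT this model (expectations undefined);
stated in the bundle text.

References: [ConnollyHighamMary2021] Lemma 4.4/4.5; [ArarEtAl2023] §3; FLoPS
[ChangParkLimNagarakatte2026] (P3109 + SR variants in Lean, independent roundings) — positioning in
file II.
-/

namespace Summit.Ventures.CertifiedArithmetic.LowPrec.SR

open Literature.ComputerArithmetic.ConnollyHighamMary2021
open Finset

section Hull

variable {K : Type*} [LinearOrder K]

/-! ### The representable hull and saturation -/

/-- `x` lies in the representable hull of `F`: some element of `F` is `≤ x` and some is `≥ x`
(for nonempty `F`: `min F ≤ x ≤ max F`). Decidable. -/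
def InHull (F : Finset K) (x : K) : Prop := (∃ y ∈ F, y ≤ x) ∧ ∃ y ∈ F, x ≤ y

/-- Hull membership is decidable (finitely many candidates). -/
instance instDecidableInHull (F : Finset K) (x : K) : Decidable (InHull F x) := by
  unfold InHull; infer_instance

/-- Saturation: clamp `x` into `[min F, max F]` (junk value `x` for empty `F`). -/
def clamp (F : Finset K) (x : K) : K :=
  if h : F.Nonempty then max (F.min' h) (min x (F.max' h)) else x

/-- The clamped value lies in the hull. -/
theorem clamp_inHull {F : Finset K} (h : F.Nonempty) (x : K) : InHull F (clamp F x) := by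
  unfold clamp; rw [dif_pos h]
  refine ⟨⟨F.min' h, F.min'_mem h, le_max_left _ _⟩, ⟨F.max' h, F.max'_mem h, ?_⟩⟩
  exact max_le (F.min'_le_max' h) (min_le_right _ _)

/-- Clamping fixes every point of the hull. -/
theorem clamp_eq_self {F : Finset K} {x : K} (hx : InHull F x) : clamp F x = x := by
  obtain ⟨⟨y, hy, hyx⟩, ⟨z, hz, hxz⟩⟩ := hx
  have h : F.Nonempty := ⟨y, hy⟩
  unfold clamp; rw [dif_pos h]
  have h1 : F.min' h ≤ x := (F.min'_le y hy).trans hyx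
  have h2 : x ≤ F.max' h := hxz.trans (F.le_max' z hz)
  rw [min_eq_left h2, max_eq_right h1]

/-- A point is fixed by clamping iff it lies in the hull. -/
theorem clamp_eq_self_iff {F : Finset K} (h : F.Nonempty) (x : K) : clamp F x = x ↔ InHull F x :=
  ⟨fun hc => hc ▸ clamp_inHull h x, clamp_eq_self⟩

/-- Upper candidate of the saturating stochastic rounding of `c` into `F`. -/
def up (F : Finset K) (c : K) : K := roundUp F (clamp F c)

/-- Lower candidate of the saturating stochastic rounding of `c` into `F`. -/
def dn (F : Finset K) (c : K) : K := roundDown F (clamp F c)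

/-- The upper candidate of a saturating SR step is a format value. -/
theorem up_mem {F : Finset K} (h : F.Nonempty) (c : K) : up F c ∈ F :=
  roundUp_mem (clamp_inHull h c).2

/-- The lower candidate of a saturating SR step is a format value. -/
theorem dn_mem {F : Finset K} (h : F.Nonempty) (c : K) : dn F c ∈ F :=
  roundDown_mem (clamp_inHull h c).1

end Hull

variable {K : Type*} [Field K] [LinearOrder K] [IsStrictOrderedRing K]

/-- Probability of the upper candidate (mode 2 / SR-nearness applied to the clamped value). -/
def pUp (F : Finset K) (c : K) : K := probUp F (clamp F c)

/-- The up-probability is nonnegative. -/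
theorem pUp_nonneg (F : Finset K) (c : K) : 0 ≤ pUp F c := probUp_nonneg F _

/-- The up-probability is at most one. -/
theorem pUp_le_one (F : Finset K) (c : K) : pUp F c ≤ 1 := probUp_le_one F _

/-! ### One step: expectation operator, mean, conditional variance -/

/-- One-step expectation `E[f(SR(c))] = p f(⌈c̄⌉) + (1 − p) f(⌊c̄⌋)`, `c̄ = clamp F c`. -/
def step (F : Finset K) (c : K) (f : K → K) : K :=
  pUp F c * f (up F c) + (1 - pUp F c) * f (dn F c)

omit [IsStrictOrderedRing K] in
/-- One-step expectation of a constant. -/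
theorem step_const (F : Finset K) (c a : K) : step F c (fun _ => a) = a := by
  unfold step; ring

omit [IsStrictOrderedRing K] in
/-- One-step expectation is additive. -/
theorem step_add (F : Finset K) (c : K) (f g : K → K) :
    step F c (fun t => f t + g t) = step F c f + step F c g := by
  unfold step; ring

omit [IsStrictOrderedRing K] in
/-- One-step expectation commutes with scalars. -/
theorem step_mul_left (F : Finset K) (c a : K) (f : K → K) :
    step F c (fun t => a * f t) = a * step F c f := by
  unfold step; ring

/-- One-step expectation is monotone (probabilities lie in `[0,1]`). -/
theorem step_mono (F : Finset K) (c : K) {f g : K → K} (h : ∀ t, f t ≤ g t) :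
    step F c f ≤ step F c g := by
  unfold step
  have hp := pUp_nonneg F c
  have hq : 0 ≤ 1 - pUp F c := sub_nonneg.mpr (pUp_le_one F c)
  exact add_le_add (mul_le_mul_of_nonneg_left (h _) hp) (mul_le_mul_of_nonneg_left (h _) hq)

omit [IsStrictOrderedRing K] in
/-- One-step expectation only depends on the values at the two candidates. -/
theorem step_congr (F : Finset K) (c : K) {f g : K → K} (hu : f (up F c) = g (up F c))
    (hd : f (dn F c) = g (dn F c)) : step F c f = step F c g := by
  unfold step; rw [hu, hd]

omit [IsStrictOrderedRing K] in
/-- **Mean of one saturating SR step** `E[SR(c)] = clamp F c` (CHM21 Lemma 4.4 applied to the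
clamped value). -/
theorem step_id (F : Finset K) (c : K) : step F c (fun t => t) = clamp F c :=
  srMean_eq_self F (clamp F c)

omit [IsStrictOrderedRing K] in
/-- **Saturation is the exact obstruction to unbiasedness**: one SR step into a nonempty finite
format is unbiased iff the pre-rounding value lies in the hull `[min F, max F]`. -/
theorem step_id_eq_self_iff {F : Finset K} (h : F.Nonempty) (c : K) :
    step F c (fun t => t) = c ↔ InHull F c := by
  rw [step_id]; exact clamp_eq_self_iff h c

omit [IsStrictOrderedRing K] in
/-- Mean independence in this model (CHM21 Lemma 4.5): conditionally on the current pre-rounding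
value `c` in the hull, the rounding increment has mean zero. -/
theorem step_centered {F : Finset K} {c : K} (hc : InHull F c) : step F c (fun t => t - c) = 0 := by
  have h1 : step F c (fun t => t - c) = step F c (fun t => t) + step F c (fun _ => -c) := by
    rw [← step_add]; exact step_congr F c (sub_eq_add_neg _ c) (sub_eq_add_neg _ c)
  rw [h1, step_id, step_const, clamp_eq_self hc]; ring

/-- The conditional variance of one step is El Arar et al.'s `v_F(c̄) = (c̄ − ⌊c̄⌋)(⌈c̄⌉ − c̄)`;
more generally the second moment about any shifted centre splits exactly. -/
theorem step_sq_add (F : Finset K) (c b : K) :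
    step F c (fun t => (t + b) ^ 2) = srVar F (clamp F c) + (clamp F c + b) ^ 2 := by
  have hm : probUp F (clamp F c) * roundUp F (clamp F c)
      + (1 - probUp F (clamp F c)) * roundDown F (clamp F c) = clamp F c := srMean_eq_self F _
  unfold step srVar pUp up dn
  linear_combination (2 * (b + clamp F c)) * hm

end Summit.Ventures.CertifiedArithmetic.LowPrec.SR
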